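import Summits.HubbardSuperconductivity.HubbardSuperconductivity.Theorems.BirComplexStableXYR.Negative.LoadBearing
import Literature.Probability.LatticeModels.GinibreInequality
import Literature.Probability.LatticeModels.RotatorAngleCubeGinibre
import Literature.Probability.LatticeModels.MMPInequality
import HarnessLib

/-!
# Crux `BirComplexStableXYR` (stmt-HubbardSuperconductivity-14845) on the real ferromagnetic cone —
# I. Dictionary: real symmetric window tables are generalised plane rotators (Ginibre models) on `U(1)^Λ`

Support file (prover seat 0, route BalabanIR).  For a finite Fourier table `c : (W_r → ℤ) →₀ ℂ` on the
window `W_r = Fin r × Fin r × Fin r` that is REAL (`Im c_n = 0`) and SYMMETRIC (`c_{-n} = c_n`), the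
engine's local generating function `F(φ) = Σ_n c_n e^{i n·φ}` is real, `F(φ) = Σ_n Re c_n cos(n·φ)`
(`ferro_genF_eq_ofReal`), so the Boltzmann weight `e^{-A(θ)}`, `A = K Σ_s F(θ ∘ sh s)`, is a positive real
(`ferro_cexp_neg_action`), and — after the folklore change of variables `θ ↦ (e^{iθ_v})_v` of
`Literature.Probability.LatticeModels.RotatorAngleCubeGinibre` — it is `e^{-K|Λ| Re c_0}` times the Gibbs
weight of a GINIBRE MODEL on the torus `U(1)^Λ` (`Literature.Probability.LatticeModels.ginibreWeight`) whose
interaction characters are the translated frequency characters `u ↦ ∏_w u_{sh s w}^{n_w}`, `(s, n) ∈ Λ × (supp c ∖ {0})`,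
with couplings `J_{(s,n)} = -K Re c_n` (`ferro_weight_eq_ginibreWeight`); the equal-time slice observable
`|Σ_x e^{iθ(x,0)}|²/L⁴` is `L⁻⁴ Σ_{x,y} Re χ_{(y,0),(x,0)}` (`ferro_sliceObs_eq`), and ratios of cube integrals are
ratios of Haar integrals (`ferro_cube_ratio_eq_torus_ratio`).  File II (`…FerroCone.lean`) feeds this into the
tree's Ginibre inequality and the proved XY anchor `birSliceXYOrderRP_proof`.

All objects are the named verbatim pieces `genF`, `sh`, `action`, `cube`, `partZ`, `Λ`, `W`, `Freq`, `Table`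
of `Theorems.BirComplexStableXY.Negative.WitnessTable`; no definition is introduced (the character family is
packaged as an existence statement with its defining equation, `ferro_exists_freqChar`).

References: J. Ginibre, Comm. Math. Phys. 16 (1970) 310–328 (plane-rotator example) [Ginibre1970];
S. Friedli, Y. Velenik, *Statistical Mechanics of Lattice Systems*, CUP 2017, §3.8–3.9, §9.1 [FriedliVelenik2017].
-/

noncomputable section

namespace Summit.HubbardSuperconductivity.HubbardSuperconductivity.Theorems

open scoped BigOperators ComplexConjugate
open MeasureTheory Literature.Probability.LatticeModels
open Summit.HubbardSuperconductivity.BirComplexStableXYNegative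

section FerroConeBridge

variable {r : ℕ}

/-- **Real symmetric tables have a real generating function**: if `Im c_n = 0` and `c_{-n} = c_n` for all
`n`, then `F(φ) = Σ_n c_n e^{i n·φ} = Σ_n Re c_n · cos(n·φ)` (pair `n` with `-n`). [folklore] -/
theorem ferro_genF_eq_ofReal (c : Table r) (hre : ∀ n, (c n).im = 0) (hsy : ∀ n, c (-n) = c n)
    (φ : W r → ℝ) :
    genF c φ = ((c.sum (fun n a => a.re * Real.cos (∑ w, (n w : ℝ) * φ w)) : ℝ) : ℂ) := by
  have hmem : ∀ n, n ∈ c.support ↔ -n ∈ c.support := fun n => by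
    rw [Finsupp.mem_support_iff, Finsupp.mem_support_iff, hsy]
  have hc : ∀ n, (c n : ℂ) = (((c n).re : ℝ) : ℂ) := fun n =>
    Complex.ext (by simp) (by simp [hre n])
  have h1 : genF c φ =
      ∑ n ∈ c.support, c n * Complex.exp (Complex.I * ((∑ w, (n w : ℝ) * φ w : ℝ) : ℂ)) := rfl
  have h2 : genF c φ =
      ∑ n ∈ c.support, c n * Complex.exp (-(Complex.I * ((∑ w, (n w : ℝ) * φ w : ℝ) : ℂ))) := by
    rw [h1]
    refine Finset.sum_equiv (Equiv.neg (Freq r)) (fun n => ?_) (fun n _ => ?_)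
    · exact hmem n
    · simp only [Equiv.neg_apply, hsy, Pi.neg_apply, Int.cast_neg, neg_mul, Finset.sum_neg_distrib,
        Complex.ofReal_neg, mul_neg, neg_neg]
  have h3 : genF c φ + genF c φ =
      ∑ n ∈ c.support, c n * (2 * Complex.cos (((∑ w, (n w : ℝ) * φ w : ℝ) : ℂ))) := by
    nth_rewrite 1 [h1]
    rw [h2, ← Finset.sum_add_distrib]
    refine Finset.sum_congr rfl fun n _ => ?_
    rw [Complex.two_cos, ← mul_add]
    congr 1
    rw [mul_comm Complex.I, neg_mul]
  have h4 : genF c φ = ∑ n ∈ c.support, c n * Complex.cos (((∑ w, (n w : ℝ) * φ w : ℝ) : ℂ)) := by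
    have : (2 : ℂ) * genF c φ = 2 * ∑ n ∈ c.support, c n * Complex.cos (((∑ w, (n w : ℝ) * φ w : ℝ) : ℂ)) := by
      rw [two_mul, h3, Finset.mul_sum]
      refine Finset.sum_congr rfl fun n _ => ?_
      ring
    exact mul_left_cancel₀ two_ne_zero this
  rw [h4]
  show _ = (((∑ n ∈ c.support, (c n).re * Real.cos (∑ w, (n w : ℝ) * φ w)) : ℝ) : ℂ)
  push_cast
  refine Finset.sum_congr rfl fun n _ => ?_
  conv_lhs => rw [hc n]

/-- For a real symmetric table the Boltzmann weight `e^{-A(θ)}` is the positive real number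
`exp(-K Σ_s Σ_n Re c_n cos(n·θ∘sh s))`. [folklore] -/
theorem ferro_cexp_neg_action (K : ℝ) (c : Table r) (hre : ∀ n, (c n).im = 0) (hsy : ∀ n, c (-n) = c n)
    (L M : ℕ) [NeZero L] [NeZero M] (θ : Λ L M → ℝ) :
    Complex.exp (-(action K c L M θ)) =
      ((Real.exp (-(K * ∑ s : Λ L M,
        c.sum (fun n a => a.re * Real.cos (∑ w, (n w : ℝ) * θ (sh L M s w))))) : ℝ) : ℂ) := by
  rw [action]
  simp_rw [ferro_genF_eq_ofReal c hre hsy]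
  rw [Complex.ofReal_exp]
  push_cast
  ring_nf

/-- Splitting off the constant mode: `Σ_{n ∈ supp c} Re c_n cos(n·φ) = Re c_0 + Σ_{n ∈ supp c ∖ {0}} Re c_n cos(n·φ)`. -/
theorem ferro_tableSum_split (c : Table r) (φ : W r → ℝ) :
    c.sum (fun n a => a.re * Real.cos (∑ w, (n w : ℝ) * φ w)) =
      (c 0).re + ∑ n ∈ c.support.erase 0, (c n).re * Real.cos (∑ w, (n w : ℝ) * φ w) := by
  show ∑ n ∈ c.support, (c n).re * Real.cos (∑ w, (n w : ℝ) * φ w) = _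
  by_cases h0 : (0 : Freq r) ∈ c.support
  · rw [← Finset.add_sum_erase _ _ h0]
    simp
  · have hc0 : c 0 = 0 := by simpa [Finsupp.mem_support_iff] using h0
    rw [Finset.erase_eq_of_notMem h0, hc0]
    simp

/-- **Frequency characters** of the torus `U(1)^Λ`: for every translate `s` and frequency `n : W_r → ℤ`
the map `u ↦ ∏_w u_{sh s w}^{n_w}` is a continuous unitary character (packaged as an existence statement
with its defining equation; no definition is introduced). [folklore] -/
theorem ferro_exists_freqChar (L M : ℕ) [NeZero L] [NeZero M] :
    ∃ χ : (Λ L M × Freq r) → ((Λ L M → Circle) →ₜ* Circle),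
      ∀ s n u, χ (s, n) u = ∏ w, u (sh L M s w) ^ (n w) := by
  refine ⟨fun i =>
    { toFun := fun u => ∏ w, u (sh L M i.1 w) ^ (i.2 w)
      map_one' := by simp
      map_mul' := fun u v => by
        simp only [Pi.mul_apply, mul_zpow, Finset.prod_mul_distrib]
      continuous_toFun := continuous_finsetProd _ fun w _ => (continuous_apply _).zpow (i.2 w) },
    fun s n u => rfl⟩

/-- The real part of a frequency character at `u = e^{iθ}` is the cosine `cos(Σ_w n_w θ_{sh s w})`. [folklore] -/
theorem ferro_reChar_freqChar_exp {L M : ℕ} [NeZero L] [NeZero M]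
    (χ : (Λ L M × Freq r) → ((Λ L M → Circle) →ₜ* Circle))
    (hχ : ∀ s n u, χ (s, n) u = ∏ w, u (sh L M s w) ^ (n w)) (s : Λ L M) (n : Freq r) (θ : Λ L M → ℝ) :
    reChar (χ (s, n)) (fun v => Circle.exp (θ v)) = Real.cos (∑ w, (n w : ℝ) * θ (sh L M s w)) := by
  rw [reChar, hχ]
  have : (((∏ w, (Circle.exp (θ (sh L M s w))) ^ (n w) : Circle) : ℂ)) =
      Complex.exp (((∑ w, (n w : ℝ) * θ (sh L M s w) : ℝ) : ℂ) * Complex.I) := by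
    rw [← Circle.coeHom_apply, map_prod]
    simp only [Circle.coeHom_apply]
    push_cast
    rw [Finset.sum_mul, Complex.exp_sum]
    refine Finset.prod_congr rfl fun w _ => ?_
    rw [← Complex.exp_int_mul]
    congr 1
    ring
  rw [this, Complex.exp_ofReal_mul_I_re]

/-- **The Ginibre Hamiltonian of a table.** For a finite set `S` of frequencies and couplings `J`, the Ginibre
Hamiltonian of the character family `(s, n) ↦ χ_{(s,n)}`, `n ∈ S`, evaluated at `e^{iθ}`, is
`Σ_s Σ_{n ∈ S} J_{(s,n)} · cos(n·θ∘sh s)`. [folklore] -/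
theorem ferro_ginibreHamiltonian_exp {L M : ℕ} [NeZero L] [NeZero M]
    (χ : (Λ L M × Freq r) → ((Λ L M → Circle) →ₜ* Circle))
    (hχ : ∀ s n u, χ (s, n) u = ∏ w, u (sh L M s w) ^ (n w)) (S : Finset (Freq r))
    (J : Λ L M × ↥S → ℝ) (θ : Λ L M → ℝ) :
    ginibreHamiltonian (fun i : Λ L M × ↥S => χ (i.1, (i.2 : Freq r))) J (fun v => Circle.exp (θ v)) =
      ∑ s : Λ L M, ∑ n : ↥S, J (s, n) * Real.cos (∑ w, ((n : Freq r) w : ℝ) * θ (sh L M s w)) := by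
  rw [ginibreHamiltonian, Fintype.sum_prod_type]
  refine Finset.sum_congr rfl fun s _ => Finset.sum_congr rfl fun n _ => ?_
  rw [ferro_reChar_freqChar_exp χ hχ]

/-- **A real symmetric table is a Ginibre model.** With `S = supp c ∖ {0}` and couplings `J_{(s,n)} = -K Re c_n`:
`exp(-K Σ_s Σ_n Re c_n cos(n·θ∘sh s)) = exp(-K |Λ| Re c_0) · ginibreWeight χ J (e^{iθ})`. [folklore] -/
theorem ferro_weight_eq_ginibreWeight (K : ℝ) (c : Table r) {L M : ℕ} [NeZero L] [NeZero M]
    (χ : (Λ L M × Freq r) → ((Λ L M → Circle) →ₜ* Circle))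
    (hχ : ∀ s n u, χ (s, n) u = ∏ w, u (sh L M s w) ^ (n w)) (θ : Λ L M → ℝ) :
    Real.exp (-(K * ∑ s : Λ L M, c.sum (fun n a => a.re * Real.cos (∑ w, (n w : ℝ) * θ (sh L M s w))))) =
      Real.exp (-(K * Fintype.card (Λ L M) * (c 0).re)) *
        ginibreWeight (fun i : Λ L M × ↥(c.support.erase 0) => χ (i.1, (i.2 : Freq r)))
          (fun i => -(K * (c (i.2 : Freq r)).re)) (fun v => Circle.exp (θ v)) := by
  rw [ginibreWeight, ferro_ginibreHamiltonian_exp χ hχ, ← Real.exp_add]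
  congr 1
  simp_rw [ferro_tableSum_split c]
  rw [Finset.sum_add_distrib, Finset.sum_const, Finset.card_univ, nsmul_eq_mul, mul_add, neg_add]
  congr 1
  · ring
  · rw [Finset.mul_sum, ← Finset.sum_neg_distrib]
    refine Finset.sum_congr rfl fun s _ => ?_
    rw [← Finset.sum_coe_sort (c.support.erase 0), Finset.mul_sum, ← Finset.sum_neg_distrib]
    refine Finset.sum_congr rfl fun n _ => ?_
    ring

/-- **The slice observable is an average of two-point characters**:
`|Σ_x e^{iθ(x,0)}|² / L⁴ = L⁻⁴ Σ_{x,y} Re χ_{(y,0),(x,0)}(e^{iθ})`. [folklore] -/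
theorem ferro_sliceObs_eq (L M : ℕ) [NeZero L] [NeZero M] (θ : Λ L M → ℝ) :
    ‖∑ x : TorusSite 2 L, Complex.exp (Complex.I * (θ (x, 0) : ℂ))‖ ^ 2 / (L : ℝ) ^ 4 =
      (∑ x : TorusSite 2 L, ∑ y : TorusSite 2 L,
        reChar (diffChar ((y, (0 : ZMod M)) : Λ L M) (x, 0)) (fun v => Circle.exp (θ v))) / (L : ℝ) ^ 4 := by
  congr 1
  have h := congrArg Complex.re (BirComplexStableXYR.Negative.normSq_sliceSum_eq L M θ)
  simp_rw [BirComplexStableXYR.Negative.sum_frq_mul] at h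
  rw [Complex.ofReal_re] at h
  rw [h, Complex.re_sum]
  refine Finset.sum_congr rfl fun x _ => ?_
  rw [Complex.re_sum]
  refine Finset.sum_congr rfl fun y _ => ?_
  rw [reChar_diffChar_exp, mul_comm Complex.I, Complex.exp_ofReal_mul_I_re]

/-- **Ratios of angle-cube integrals are ratios of Haar integrals** (the factors `(2π)^{|Λ|}` cancel). [folklore] -/
theorem ferro_cube_ratio_eq_torus_ratio (L M : ℕ) [NeZero L] [NeZero M]
    (G₁ G₂ : (Λ L M → Circle) → ℝ) (h₁ : Continuous G₁) (h₂ : Continuous G₂) :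
    (∫ θ in cube L M, G₁ (fun v => Circle.exp (θ v))) / (∫ θ in cube L M, G₂ (fun v => Circle.exp (θ v))) =
      (∫ u, G₁ u ∂torusHaar (Λ L M)) / (∫ u, G₂ u ∂torusHaar (Λ L M)) := by
  rw [cube, setIntegral_angleCube_comp_exp G₁ h₁.aestronglyMeasurable,
    setIntegral_angleCube_comp_exp G₂ h₂.aestronglyMeasurable, smul_eq_mul, smul_eq_mul,
    mul_div_mul_left _ _ (by positivity)]

/-- **Slice ratio = average of Ginibre two-point expectations.** For any finite character family `χ'` with
couplings `J` on `U(1)^Λ`: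
`(∫ (L⁻⁴ Σ_{x,y} Re χ_{(y,0),(x,0)}) e^{H} dHaar) / (∫ e^{H} dHaar) = L⁻⁴ Σ_{x,y} ⟨Re χ_{(y,0),(x,0)}⟩_J`. [folklore] -/
theorem ferro_torus_ratio_eq_sum_ginibreExpect {ι : Type*} [Fintype ι] (L M : ℕ) [NeZero L] [NeZero M]
    (χ' : ι → ((Λ L M → Circle) →ₜ* Circle)) (J : ι → ℝ) :
    (∫ u, (∑ x : TorusSite 2 L, ∑ y : TorusSite 2 L,
        reChar (diffChar ((y, (0 : ZMod M)) : Λ L M) (x, 0)) u) / (L : ℝ) ^ 4 * ginibreWeight χ' J u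
          ∂torusHaar (Λ L M)) / (∫ u, ginibreWeight χ' J u ∂torusHaar (Λ L M)) =
      (∑ x : TorusSite 2 L, ∑ y : TorusSite 2 L,
        ginibreExpect (torusHaar (Λ L M)) χ' J (reChar (diffChar ((y, (0 : ZMod M)) : Λ L M) (x, 0)))) /
          (L : ℝ) ^ 4 := by
  have hwc : Continuous (ginibreWeight χ' J) := continuous_ginibreWeight χ' J
  have hint : ∀ x y : TorusSite 2 L, Integrable
      (fun u => reChar (diffChar ((y, (0 : ZMod M)) : Λ L M) (x, 0)) u * ginibreWeight χ' J u)
      (torusHaar (Λ L M)) := fun x y =>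
    integrable_torusHaar_of_continuous (((continuous_reChar _).mul hwc))
  have hnum : ∫ u, (∑ x : TorusSite 2 L, ∑ y : TorusSite 2 L,
        reChar (diffChar ((y, (0 : ZMod M)) : Λ L M) (x, 0)) u) / (L : ℝ) ^ 4 * ginibreWeight χ' J u
          ∂torusHaar (Λ L M) =
      (∑ x : TorusSite 2 L, ∑ y : TorusSite 2 L,
        ∫ u, reChar (diffChar ((y, (0 : ZMod M)) : Λ L M) (x, 0)) u * ginibreWeight χ' J u
          ∂torusHaar (Λ L M)) / (L : ℝ) ^ 4 := by
    have : (fun u => (∑ x : TorusSite 2 L, ∑ y : TorusSite 2 L,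
        reChar (diffChar ((y, (0 : ZMod M)) : Λ L M) (x, 0)) u) / (L : ℝ) ^ 4 * ginibreWeight χ' J u) =
        fun u => (∑ x : TorusSite 2 L, ∑ y : TorusSite 2 L,
          reChar (diffChar ((y, (0 : ZMod M)) : Λ L M) (x, 0)) u * ginibreWeight χ' J u) / (L : ℝ) ^ 4 := by
      funext u
      rw [div_mul_eq_mul_div, Finset.sum_mul]
      simp_rw [Finset.sum_mul]
    rw [this, integral_div, integral_finsetSum _ (fun x _ => integrable_finsetSum _ (fun y _ => hint x y))]
    congr 1
    refine Finset.sum_congr rfl fun x _ => ?_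
    rw [integral_finsetSum _ (fun y _ => hint x y)]
  rw [hnum]
  simp only [ginibreExpect]
  simp_rw [← Finset.sum_div]
  rw [div_right_comm]

end FerroConeBridge

end Summit.HubbardSuperconductivity.HubbardSuperconductivity.Theorems

end
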